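import Summits.QuantumFields.YangMills.Theorems.UnitScaleTiltProp8ChartDoubleBarDiffBall
import Summits.QuantumFields.YangMills.Theorems.UnitScaleTiltProp8ChartDoubleBarDeriv
import Summits.QuantumFields.YangMills.Theorems.UnitScaleTiltProp8ChartDoubleBarOneStep
import Summits.QuantumFields.YangMills.Theorems.UnitScaleTiltProp8ChartLocalityFlat
import Summits.QuantumFields.YangMills.Theorems.UnitScaleTiltProp8ChartQuadraticWeighted
import Literature.MathematicalPhysics.QuantumFieldTheory.Balaban1983to89.B5AveragingLocalityV1
import Literature.MathematicalPhysics.QuantumFieldTheory.Balaban1983to89.B6SectAOntoV1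
import HarnessLib

/-!
# Route `UnitScaleTilt`, crux K1 «MinimiserStabilityRegPr» (stmt-QuantumFields-19200), stub V2′ `stub_halvingStep` (H = `hP1room`, (P3-top-b) «LINEAR», row (L2)):
# **THE k-FOLD DOUBLE-BAR AVERAGE IN LOG COORDINATES IS THE STRAIGHT TUBE `Lᵏ·Q_k` UP TO SECOND ORDER, ON THE READ TERRITORY OF ONE COARSE BOND**
# `‖−i·log U̿^{(k)}(e^{iηA})(c) − η·Lᵏ·(Q_kA)(c)‖ ≤ 64·60800·ℓ²·(Lᵏ·η·s)²` for `‖A‖ ≤ s` on the fine bonds under the two `k`-blocks of `c`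

Cell `ym3-torus` (HUMAN RULING D-0037: YM₃ on T³ is ladder rung R3 — NOT d = 4, NOT a mass gap, NOT the Clay problem), width seat `ym-ust-19200-w6` gen 2
(LEAD-H ★w5-19200 g4 RULING L-9 (2) «(P3-top-b): LINEAR … the k-fold `log U̿ − Lᵏ·bondAvg = O(2)`»; ★w8-19936 g2 13:25:09Z∕13:34:20Z (L2) «shape I will consume at a top
bond `c` with both ends over N05's `Λs k`»).  `--supports stmt-QuantumFields-19200 --as helper`; THEOREMS ONLY (0 `def`, 0 `sorry`); count-neutral; nothing here is a
claim about `core′`, the stub, the crux, the rung or the mass gap.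

WHAT (any `P : Params`, matrices `Matrix n n ℂ` in the `L²`-operator norm; `ℓ = (d+2)L`):
* §1 `bondAvgIter_eq_zero_of_vanish_on_reads`, ★`bondAvgIter_congr_of_reads` — the READ SET of the straight `k`-fold tube average `(Q_kA)(c)` ([Balaban1984PropagatorsI]
  (1.18)): the fine bonds `b` with `Bᵏ(b₋), Bᵏ(b₊) ∈ {c₋, c₊}` (the same set as ✓`Prop8ChartDoubleBar.dbarIterU_congr_of_agree`'s; any real vector space of values).
* §2 ★`exists_hasFDerivAt_chartLogAt_zero` — `D[A ↦ −i·log U̿^{(k)}(e^{iηA})(c)](0)·Y = (η·Lᵏ)·(Q_kY)(c)` (✓`exists_hasFDerivAt_coe_dbarIterU_expCfg_zero` ∘ `D log(1) = id`;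
  the `D`-free reading of ✓`fderiv_chartLogFlat_zero_apply`).
* §3 ★★★`norm_chartLogAt_sub_smul_bondAvgIter_le_of_reads` — THE SECOND-ORDER ROW: for `0 < η`, `0 ≤ s`, the budget `243200·ℓ²·Lᵏ·η·s ≤ 1` and `‖A b‖ ≤ s` on
  the read set of `c`: `‖−i·log U̿^{(k)}(e^{iηA})(c) − (η·Lᵏ)·(Q_kA)(c)‖ ≤ 64·60800·ℓ²·(Lᵏ·η·s)²`; ★★`norm_mlog_dbarIterU_sub_smul_bondAvgIter_le_of_reads` — the same
  without the factor `−i`: `‖log U̿^{(k)}(e^{iηA})(c) − (i·η·Lᵏ)·(Q_kA)(c)‖ ≤ 64·60800·ℓ²·(Lᵏ·η·s)²`.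
MECHANISM (no induction over the levels): the generic Cauchy engine ✓`ChartQuadraticWeighted.norm_sub_fderiv_le_weightedBall` (unit weights, one output index) applied to
the READ TRUNCATION `A′ := 𝟙_{reads(c)}·A` — so the global sup-ball IS the read ball — with holomorphy on the ball of radius `R′ := (60800ℓ²Lᵏη)⁻¹` from
✓`differentiableAt_coe_dbarIterU_of_reads` (B1 ✓`norm_dbarAvgU_sub_one_le`, `C₁ = 3800`) ∘ ✓`MatrixLog.analyticAt_mlog`, the sup letter `B = 8Lᵏ·η·R′` from
✓`norm_dbarIterU_sub_one_le_two_mul` ∘ ✓`MatrixLog.norm_mlog_le_two_mul`, the derivative of §2, and the transfer `A′ ↦ A` by ✓`dbarIterU_congr_of_agree` and §1; the engine's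
`8B∕R′²·s² = 64Lᵏη·s²∕R′` at the maximal `R′` is the displayed constant.  (The family∕weighted-ball version at every index of a nested family is ✓`…ChartQuadraticFlat.
norm_chartLogFlat_sub_fderiv_le_weightedBall`; this file is its `D`-free read-territory reading for ONE coarse bond, as the (P3-top-b) consumer asked.)
HONEST SCOPE.  Flat background only; constants crude (numerals, `ℓ`, `L`); nothing of [Balaban1985RegularSpaces] Prop. 5, of `core′`, the stub or the crux is proved here.

References: T. Bałaban, CMP **98** (1985) 17–51 [Balaban1985Averaging] ((125)–(127) p.36, Prop. 4 (134)–(135) p.38); CMP **102** (1985) 277–309 [Balaban1985Variational]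
((20) p.281, (44) p.285, (152)–(156) pp.301–302); CMP **95** (1984) 17–40 [Balaban1984PropagatorsI] ((1.11) p.19, (1.16)–(1.18) pp.19–20).
-/

set_option autoImplicit false

noncomputable section

open scoped BigOperators
open NormedSpace

namespace Summit.QuantumFields.YangMills.Theorems.Prop8ChartDoubleBar

open Literature.MathematicalPhysics.QuantumFieldTheory.Balaban1983to89
open T4Continuum BlockAveraging ExpMeanLog MatrixLog LatticeFieldCalculus
open B5Eq118OneStroke (iterBlockOf iterBlockOf_succ iterBlockOf_zero)
open B5Eq120IterProof (bondAvgIter_zero bondAvgIter_succ)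
open B5AveragingLocalityV1 (bondAvg_eq_zero_of_local)
open B6SectAOntoV1 (bondAvgIterLin bondAvgIterLin_apply)
open B7TransferAnalyticMean (hasFDerivAt_mlog_one)
open Summit.QuantumFields.YangMills.Theorems.Prop8Chart (expCfg coe_expCfg expCfg_zero norm_coe_expCfg_sub_one_le)
open Summit.QuantumFields.YangMills.Theorems.ChartQuadraticWeighted (norm_sub_fderiv_le_weightedBall)

variable {P : Params}

/-! ## §1 The read set of the straight tube average `Q_k` -/

section ReadSet

variable {V : Type*} [AddCommGroup V] [Module ℝ V]

/-- **`(Q_kX)(c) = 0` WHEN `X` VANISHES ON THE READ SET OF `c`** (the fine bonds `b` with `Bᵏ(b₋), Bᵏ(b₊) ∈ {c₋, c₊}`): induction over the levels with the one-step block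
locality ✓`B5AveragingLocalityV1.bondAvg_eq_zero_of_local`. [cite: Balaban1984PropagatorsI, (1.11) p.19, (1.18) p.20] -/
theorem bondAvgIter_eq_zero_of_vanish_on_reads :
    ∀ (k : ℕ), k ≤ P.m + P.K → ∀ {X : VecField P 0 V} (c : PBond P k),
      (∀ b : PBond P 0, (iterBlockOf k b.src = c.src ∨ iterBlockOf k b.src = c.tgt) →
        (iterBlockOf k b.tgt = c.src ∨ iterBlockOf k b.tgt = c.tgt) → X b = 0) →
      bondAvgIter k X c = 0
  | 0, _, X, c, h => by
    rw [bondAvgIter_zero]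
    exact h c (Or.inl (iterBlockOf_zero _)) (Or.inr (iterBlockOf_zero _))
  | k + 1, hk, X, c, h => by
    rw [bondAvgIter_succ]
    refine bondAvg_eq_zero_of_local hk _ c fun e hes het =>
      bondAvgIter_eq_zero_of_vanish_on_reads k (Nat.le_of_succ_le hk) e fun b hbs hbt => h b ?_ ?_
    · rw [iterBlockOf_succ]
      rcases hbs with h1 | h1 <;> rw [h1]
      · exact hes
      · exact het
    · rw [iterBlockOf_succ]
      rcases hbt with h1 | h1 <;> rw [h1]
      · exact hes
      · exact het

/-- ★ **THE READ SET OF `(Q_kA)(c)`**: two bond fields agreeing on the fine bonds `b` with `Bᵏ(b₋), Bᵏ(b₊) ∈ {c₋, c₊}` have the same straight `k`-fold tube average at `c`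
(the same read set as the double-bar iterate's, ✓`dbarIterU_congr_of_agree`). [cite: Balaban1984PropagatorsI, (1.18) p.20] -/
theorem bondAvgIter_congr_of_reads {k : ℕ} (hk : k ≤ P.m + P.K) {A A' : VecField P 0 V} (c : PBond P k)
    (h : ∀ b : PBond P 0, (iterBlockOf k b.src = c.src ∨ iterBlockOf k b.src = c.tgt) →
      (iterBlockOf k b.tgt = c.src ∨ iterBlockOf k b.tgt = c.tgt) → A b = A' b) :
    bondAvgIter k A c = bondAvgIter k A' c := by
  have hsub : bondAvgIter k (A - A') c = 0 :=
    bondAvgIter_eq_zero_of_vanish_on_reads k hk c fun b h1 h2 => by rw [Pi.sub_apply, h b h1 h2, sub_self]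
  rw [← bondAvgIterLin_apply, map_sub, Pi.sub_apply, sub_eq_zero, bondAvgIterLin_apply, bondAvgIterLin_apply] at hsub
  exact hsub

end ReadSet

/-! ## §2 The derivative of the one-bond log chart at the flat point -/

section Matrices

open scoped Matrix.Norms.L2Operator

variable {n : Type*} [Fintype n] [DecidableEq n] [Nonempty n]

omit [Nonempty n] in
/-- ★ **`D[A ↦ −i·log U̿^{(k)}(e^{iηA})(c)](0)·Y = (η·Lᵏ)·(Q_kY)(c)`** — the one-bond, family-free reading of ✓`fderiv_chartLogFlat_zero_apply`
(✓`exists_hasFDerivAt_coe_dbarIterU_expCfg_zero` composed with `D log(1) = id` and `(−i)(iη) = η`). [cite: Balaban1985Averaging, (125)-(127) p.36; Balaban1985Variational, (20) p.281] -/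
theorem exists_hasFDerivAt_chartLogAt_zero (η : ℝ) (k : ℕ) (c : PBond P k) :
    ∃ D : (PBond P 0 → Matrix n n ℂ) →L[ℂ] Matrix n n ℂ,
      HasFDerivAt (fun A : PBond P 0 → Matrix n n ℂ => (-Complex.I) • mlog (((dbarIterU k (expCfg η A) c : (Matrix n n ℂ)ˣ) : Matrix n n ℂ))) D 0 ∧
        ∀ Y, D Y = ((η : ℂ) * ((P.L : ℕ) : ℂ) ^ k) • bondAvgIter k Y c := by
  obtain ⟨Dm, hDm, hDmQ⟩ := exists_hasFDerivAt_coe_dbarIterU_expCfg_zero (P := P) (n := n) η k c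
  have hval : ((dbarIterU k (expCfg η (0 : PBond P 0 → Matrix n n ℂ)) c : (Matrix n n ℂ)ˣ) : Matrix n n ℂ) = 1 := by
    rw [expCfg_zero, dbarIterU_one, Units.val_one]
  have hlog : HasFDerivAt (mlog : Matrix n n ℂ → Matrix n n ℂ) (1 : Matrix n n ℂ →L[ℂ] Matrix n n ℂ)
      (((dbarIterU k (expCfg η (0 : PBond P 0 → Matrix n n ℂ))) c : (Matrix n n ℂ)ˣ) : Matrix n n ℂ) := by
    rw [hval]; exact hasFDerivAt_mlog_one
  refine ⟨(-Complex.I) • ((1 : Matrix n n ℂ →L[ℂ] Matrix n n ℂ).comp Dm), (hlog.comp (0 : PBond P 0 → Matrix n n ℂ) hDm).const_smul (-Complex.I),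
    fun Y => ?_⟩
  rw [show ((-Complex.I) • ((1 : Matrix n n ℂ →L[ℂ] Matrix n n ℂ).comp Dm)) Y = (-Complex.I) • Dm Y from rfl, hDmQ, smul_smul, smul_smul]
  congr 1
  rw [← mul_assoc, show -Complex.I * Complex.I = 1 by rw [neg_mul, Complex.I_mul_I, neg_neg], one_mul]

/-! ## §3 ★★★ The second-order row on the read territory of one coarse bond -/

/-- ★★★ **THE k-FOLD DOUBLE-BAR AVERAGE IN LOG COORDINATES IS THE STRAIGHT TUBE UP TO SECOND ORDER** ((L2) of the (P3-top-b) «linear» junction): for `0 < η`, a coarse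
bond `c ∈ T^{(k)}`, `0 ≤ s` with the budget `243200·ℓ²·Lᵏ·η·s ≤ 1` (`ℓ = (d+2)L`), and every `A` with `‖A b‖ ≤ s` on the fine bonds `b` with `Bᵏ(b₋), Bᵏ(b₊) ∈ {c₋, c₊}`:
`‖−i·log U̿^{(k)}(e^{iηA})(c) − (η·Lᵏ)·(Q_kA)(c)‖ ≤ 64·60800·ℓ²·(Lᵏ·η·s)²` — k-UNIFORM numerals.  Proof: the Cauchy engine ✓`ChartQuadraticWeighted.norm_sub_fderiv_le_weightedBall`
at unit weights for the read truncation of `A` on the ball of radius `R′ = (60800ℓ²Lᵏη)⁻¹` (holomorphy ✓`differentiableAt_coe_dbarIterU_of_reads` ∘ ✓`analyticAt_mlog`, bound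
`8LᵏηR′` by ✓`norm_dbarIterU_sub_one_le_two_mul` ∘ ✓`norm_mlog_le_two_mul`), §2 for the derivative, ✓`dbarIterU_congr_of_agree` + §1 for the transfer.
[cite: Balaban1985Averaging, Prop. 4 (134)-(135) p.38, (125)-(127) p.36; Balaban1985Variational, (44) p.285, (156) p.302; Balaban1984PropagatorsI, (1.18) p.20] -/
theorem norm_chartLogAt_sub_smul_bondAvgIter_le_of_reads (η : ℝ) (hη : 0 < η) {k : ℕ} (hk : k ≤ P.m + P.K) (c : PBond P k)
    (A : PBond P 0 → Matrix n n ℂ) {s : ℝ} (hs0 : 0 ≤ s)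
    (hbudget : 243200 * (((P.d + 2) * P.L : ℕ) : ℝ) ^ 2 * (P.L : ℝ) ^ k * η * s ≤ 1)
    (hA : ∀ b : PBond P 0, (iterBlockOf k b.src = c.src ∨ iterBlockOf k b.src = c.tgt) →
      (iterBlockOf k b.tgt = c.src ∨ iterBlockOf k b.tgt = c.tgt) → ‖A b‖ ≤ s) :
    ‖(-Complex.I) • mlog (((dbarIterU k (expCfg η A) c : (Matrix n n ℂ)ˣ) : Matrix n n ℂ)) - ((η : ℂ) * ((P.L : ℕ) : ℂ) ^ k) • bondAvgIter k A c‖ ≤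
      64 * 60800 * (((P.d + 2) * P.L : ℕ) : ℝ) ^ 2 * ((P.L : ℝ) ^ k * η * s) ^ 2 := by
  classical
  -- letters: `ℓ`, `x = Lᵏ`, `M = 60800ℓ²xη`, the ball radius `R′ = M⁻¹`, the read-bond deviation `s₀ = 2ηR′`, the sup letter `B = 8xηR′`
  set ℓ : ℝ := (((P.d + 2) * P.L : ℕ) : ℝ) with hℓ
  have hℓ1 : (1 : ℝ) ≤ ℓ := by
    rw [hℓ]; exact_mod_cast Nat.one_le_iff_ne_zero.mpr (Nat.mul_ne_zero (by omega) (by have := P.hL.2; omega))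
  have hL1 : (1 : ℝ) ≤ P.L := by exact_mod_cast P.L_pos
  set x : ℝ := (P.L : ℝ) ^ k with hx
  have hx1 : (1 : ℝ) ≤ x := one_le_pow₀ hL1
  have hx0 : (0 : ℝ) < x := by positivity
  set M : ℝ := 60800 * ℓ ^ 2 * x * η with hM
  have hM0 : 0 < M := by positivity
  have hηM : η ≤ M := by
    have h1 : (1 : ℝ) ≤ ℓ ^ 2 * x := by nlinarith [one_le_pow₀ (M₀ := ℝ) hℓ1 (n := 2)]
    have : η * 1 ≤ η * (60800 * (ℓ ^ 2 * x)) := mul_le_mul_of_nonneg_left (by nlinarith) hη.le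
    calc η = η * 1 := (mul_one η).symm
      _ ≤ η * (60800 * (ℓ ^ 2 * x)) := this
      _ = M := by rw [hM]; ring
  set R' : ℝ := M⁻¹ with hR'
  have hR'0 : 0 < R' := inv_pos.mpr hM0
  have hMR' : M * R' = 1 := mul_inv_cancel₀ hM0.ne'
  have h4s : 4 * s ≤ R' := by
    have h1 : 4 * s * M ≤ 1 := by
      have : 4 * s * M = 243200 * ℓ ^ 2 * x * η * s := by rw [hM]; ring
      rw [this]; exact hbudget
    have h2 := mul_le_mul_of_nonneg_right h1 hR'0.le
    rwa [mul_assoc, hMR', mul_one, one_mul] at h2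
  have hηR' : η * R' ≤ 1 := by
    calc η * R' ≤ M * R' := mul_le_mul_of_nonneg_right hηM hR'0.le
      _ = 1 := hMR'
  set s₀ : ℝ := 2 * η * R' with hs₀
  have hs₀0 : 0 ≤ s₀ := by positivity
  have hbud : 8 * 3800 * (((P.d + 2) * P.L : ℕ) : ℝ) ^ 2 * (P.L : ℝ) ^ k * s₀ ≤ 1 := by
    have : 8 * 3800 * ℓ ^ 2 * x * s₀ = M * R' := by rw [hs₀, hM]; ring
    rw [this, hMR']
  have hxs₀ : 2 * (x * s₀) ≤ 1 / 2 := by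
    -- `2xs₀ = 4xη·R′ ≤ (M∕2)·R′ = 1∕2`
    have h1 : 4 * x * η ≤ M / 2 := by
      rw [hM]
      have : (1 : ℝ) ≤ ℓ ^ 2 := one_le_pow₀ hℓ1
      nlinarith [mul_pos hx0 hη]
    calc 2 * (x * s₀) = (4 * x * η) * R' := by rw [hs₀]; ring
      _ ≤ (M / 2) * R' := mul_le_mul_of_nonneg_right h1 hR'0.le
      _ = 1 / 2 := by rw [div_mul_eq_mul_div, hMR']
  -- the one-step letter of record (B1, `C₁ = 3800`)
  have hC₁ : (2 : ℝ) ≤ 3800 := by norm_num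
  have hstep : ∀ (j : ℕ), j + 1 ≤ P.m + P.K → ∀ (S : GaugeField P j (Matrix n n ℂ)ˣ) (c : PBond P (j + 1)) (s : ℝ), 0 ≤ s →
      48 * (((P.d + 2) * P.L : ℕ) : ℝ) * s ≤ 1 →
      (∀ b : PBond P j, (blockOf b.src = c.src ∨ blockOf b.src = c.tgt) → (blockOf b.tgt = c.src ∨ blockOf b.tgt = c.tgt) →
        ‖((S b : (Matrix n n ℂ)ˣ) : Matrix n n ℂ) - 1‖ ≤ s) →
      ‖((dbarAvgU S c : (Matrix n n ℂ)ˣ) : Matrix n n ℂ) - 1‖ ≤ (P.L : ℝ) * s + 3800 * (((P.d + 2) * P.L : ℕ) : ℝ) ^ 2 * s ^ 2 :=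
    fun j hj S c s hs0 hℓs hS => norm_dbarAvgU_sub_one_le hj c hs0 hℓs hS
  -- the read set of `c` and the one-bond log chart
  set Sk : Set (Site P k) := {y | y = c.src ∨ y = c.tgt} with hSk
  set g : (PBond P 0 → Matrix n n ℂ) → Matrix n n ℂ :=
    fun Y => (-Complex.I) • mlog (((dbarIterU k (expCfg η Y) c : (Matrix n n ℂ)ˣ) : Matrix n n ℂ)) with hg
  -- on the unit-weight sup-ball of radius `R′`: near-flat read bonds, holomorphy, the sup letter
  have hball : ∀ Y : PBond P 0 → Matrix n n ℂ, (∀ b, (1 : ℝ) * ‖Y b‖ < R') →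
      DifferentiableAt ℂ g Y ∧ ‖g Y‖ ≤ 8 * x * η * R' := by
    intro Y hY
    have hYb : ∀ b : PBond P 0, iterBlockOf k b.src ∈ Sk → iterBlockOf k b.tgt ∈ Sk →
        ‖((expCfg η Y b : (Matrix n n ℂ)ˣ) : Matrix n n ℂ) - 1‖ ≤ s₀ := by
      intro b _ _
      have hYb' : ‖Y b‖ < R' := by simpa only [one_mul] using hY b
      have hn : ‖(η : ℂ) • Y b‖ = η * ‖Y b‖ := by rw [norm_smul, Complex.norm_real, Real.norm_of_nonneg hη.le]
      have h1 : ‖(η : ℂ) • Y b‖ ≤ 1 := by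
        rw [hn]
        calc η * ‖Y b‖ ≤ η * R' := mul_le_mul_of_nonneg_left hYb'.le hη.le
          _ ≤ 1 := hηR'
      calc ‖((expCfg η Y b : (Matrix n n ℂ)ˣ) : Matrix n n ℂ) - 1‖ ≤ 2 * ‖(η : ℂ) • Y b‖ := norm_coe_expCfg_sub_one_le η Y b h1
        _ = 2 * (η * ‖Y b‖) := by rw [hn]
        _ ≤ 2 * (η * R') := by nlinarith [hYb'.le, hη.le, norm_nonneg (Y b)]
        _ = s₀ := by rw [hs₀]; ring
    have hdiff := differentiableAt_coe_dbarIterU_of_reads η hC₁ hstep k hk Sk Y s₀ hs₀0 hbud hYb c (Or.inl rfl) (Or.inr rfl)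
    have hnear := norm_dbarIterU_sub_one_le_two_mul hC₁ hstep hk Sk (expCfg η Y) hs₀0 hbud hYb c (Or.inl rfl) (Or.inr rfl)
    have hlt1 : ‖((dbarIterU k (expCfg η Y) c : (Matrix n n ℂ)ˣ) : Matrix n n ℂ) - 1‖ < 1 :=
      (hnear.trans hxs₀).trans_lt (by norm_num)
    refine ⟨((MatrixLog.analyticAt_mlog hlt1).differentiableAt.comp Y hdiff).const_smul (-Complex.I), ?_⟩
    rw [hg]
    dsimp only
    rw [norm_smul, norm_neg, Complex.norm_I, one_mul]
    calc ‖mlog (((dbarIterU k (expCfg η Y) c : (Matrix n n ℂ)ˣ) : Matrix n n ℂ))‖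
        ≤ 2 * ‖((dbarIterU k (expCfg η Y) c : (Matrix n n ℂ)ˣ) : Matrix n n ℂ) - 1‖ := norm_mlog_le_two_mul (hnear.trans hxs₀)
      _ ≤ 2 * (2 * (x * s₀)) := by linarith
      _ = 8 * x * η * R' := by rw [hs₀]; ring
  -- the Cauchy engine at unit weights, one output index, for the read truncation `A′`
  set A' : PBond P 0 → Matrix n n ℂ := fun b =>
    if (iterBlockOf k b.src = c.src ∨ iterBlockOf k b.src = c.tgt) ∧ (iterBlockOf k b.tgt = c.src ∨ iterBlockOf k b.tgt = c.tgt) then A b else 0 with hA'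
  have hA'read : ∀ b : PBond P 0, (iterBlockOf k b.src = c.src ∨ iterBlockOf k b.src = c.tgt) →
      (iterBlockOf k b.tgt = c.src ∨ iterBlockOf k b.tgt = c.tgt) → A' b = A b := fun b h1 h2 => by
    rw [hA']; dsimp only; rw [if_pos ⟨h1, h2⟩]
  have hA's : ∀ b : PBond P 0, (1 : ℝ) * ‖A' b‖ ≤ s := by
    intro b
    rw [one_mul, hA']
    dsimp only
    split_ifs with h
    · exact hA b h.1 h.2
    · rw [norm_zero]; exact hs0
  set G : (PBond P 0 → Matrix n n ℂ) → (Unit → Matrix n n ℂ) := fun Y _ => g Y with hG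
  have hG0 : G 0 = 0 := by
    funext u
    rw [hG]; dsimp only; rw [hg]; dsimp only
    rw [expCfg_zero, dbarIterU_one, Units.val_one, mlog_one, smul_zero, Pi.zero_apply]
  have hGd : DifferentiableOn ℂ G {Y : PBond P 0 → Matrix n n ℂ | ∀ b, (1 : ℝ) * ‖Y b‖ < R'} := fun Y hY =>
    (differentiableAt_pi.mpr fun _ => (hball Y hY).1).differentiableWithinAt
  have hGB : ∀ Y : PBond P 0 → Matrix n n ℂ, (∀ b, (1 : ℝ) * ‖Y b‖ < R') → ∀ u : Unit, ‖G Y u‖ ≤ 8 * x * η * R' :=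
    fun Y hY _ => (hball Y hY).2
  have key := norm_sub_fderiv_le_weightedBall (fun _ : PBond P 0 => (1 : ℝ)) (fun _ => one_pos) G hG0 hR'0 hGd hGB A' hs0 h4s hA's ()
  -- the derivative at the flat point (§2) and the transfer `A′ ↦ A`
  obtain ⟨D, hD, hDQ⟩ := exists_hasFDerivAt_chartLogAt_zero (P := P) (n := n) η k c
  have hGD : HasFDerivAt G (ContinuousLinearMap.pi fun _ : Unit => D) 0 := hasFDerivAt_pi.mpr fun _ => hD
  have hfd : (fderiv ℂ G 0) A' () = ((η : ℂ) * ((P.L : ℕ) : ℂ) ^ k) • bondAvgIter k A c := by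
    rw [hGD.fderiv, ContinuousLinearMap.pi_apply, hDQ, bondAvgIter_congr_of_reads hk c hA'read]
  have hGA : G A' () = g A := by
    rw [hG]; dsimp only; rw [hg]; dsimp only
    rw [dbarIterU_congr_of_agree k hk c fun b h1 h2 => (Units.ext (by rw [coe_expCfg, coe_expCfg, hA'read b h1 h2]) :
      expCfg η A' b = expCfg η A b)]
  rw [hGA, hfd] at key
  -- the constant: `8B∕R′²·s² = 64xηs²∕R′ = 64·60800·ℓ²·(xηs)²`
  have hconst : 8 * (8 * x * η * R') / R' ^ 2 * s ^ 2 = 64 * 60800 * ℓ ^ 2 * (x * η * s) ^ 2 := by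
    rw [hR']
    field_simp
    rw [hM]
    ring
  rw [hconst] at key
  exact key

/-- ★★ **THE SAME WITHOUT THE FACTOR `−i`**: `‖log U̿^{(k)}(e^{iηA})(c) − (i·η·Lᵏ)·(Q_kA)(c)‖ ≤ 64·60800·ℓ²·(Lᵏ·η·s)²` under the hypotheses of
✓`norm_chartLogAt_sub_smul_bondAvgIter_le_of_reads` (`‖−i·X‖ = ‖X‖`). [cite: Balaban1985Averaging, Prop. 4 (134)-(135) p.38, (125)-(127) p.36; Balaban1985Variational, (44) p.285] -/
theorem norm_mlog_dbarIterU_sub_smul_bondAvgIter_le_of_reads (η : ℝ) (hη : 0 < η) {k : ℕ} (hk : k ≤ P.m + P.K) (c : PBond P k)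
    (A : PBond P 0 → Matrix n n ℂ) {s : ℝ} (hs0 : 0 ≤ s)
    (hbudget : 243200 * (((P.d + 2) * P.L : ℕ) : ℝ) ^ 2 * (P.L : ℝ) ^ k * η * s ≤ 1)
    (hA : ∀ b : PBond P 0, (iterBlockOf k b.src = c.src ∨ iterBlockOf k b.src = c.tgt) →
      (iterBlockOf k b.tgt = c.src ∨ iterBlockOf k b.tgt = c.tgt) → ‖A b‖ ≤ s) :
    ‖mlog (((dbarIterU k (expCfg η A) c : (Matrix n n ℂ)ˣ) : Matrix n n ℂ)) - ((Complex.I * (η : ℂ)) * ((P.L : ℕ) : ℂ) ^ k) • bondAvgIter k A c‖ ≤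
      64 * 60800 * (((P.d + 2) * P.L : ℕ) : ℝ) ^ 2 * ((P.L : ℝ) ^ k * η * s) ^ 2 := by
  have h := norm_chartLogAt_sub_smul_bondAvgIter_le_of_reads η hη hk c A hs0 hbudget hA
  have heq : (-Complex.I) • mlog (((dbarIterU k (expCfg η A) c : (Matrix n n ℂ)ˣ) : Matrix n n ℂ)) - ((η : ℂ) * ((P.L : ℕ) : ℂ) ^ k) • bondAvgIter k A c =
      (-Complex.I) • (mlog (((dbarIterU k (expCfg η A) c : (Matrix n n ℂ)ˣ) : Matrix n n ℂ)) -
        ((Complex.I * (η : ℂ)) * ((P.L : ℕ) : ℂ) ^ k) • bondAvgIter k A c) := by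
    rw [smul_sub, smul_smul]
    congr 2
    rw [← mul_assoc, ← mul_assoc, show -Complex.I * Complex.I = 1 by rw [neg_mul, Complex.I_mul_I, neg_neg], one_mul]
  rw [heq, norm_smul, norm_neg, Complex.norm_I, one_mul] at h
  exact h

end Matrices

end Summit.QuantumFields.YangMills.Theorems.Prop8ChartDoubleBar

end
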